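import Summits.QuantumFields.YangMills.Theorems.LuscherReductionTwistedTraceScalingBTTailKernel
import Summits.QuantumFields.YangMills.Theorems.LuscherReductionTwistedTraceScalingBOStiffColour
import HarnessLib

/-!
# (B-ST) stub (L-1), additive part: the based kernel OFF the `T`-core is exponentially small — `K_β(U, V^{basedExt h}) ≤ e^{2β|E|} e^{−β (T/(6L) − b)²}`
# (lane A of S-BASE, crux `TwistedTraceScaling` stmt-QuantumFields-20203, C4-CORE, the (B-ST) pen; HANDOFF-g21 STUB LEDGER (L-1))

The transport `…BOStiffTransportCore.basedKernel_core_two_sided` controls the based kernel restricted to the core `C_T = {h | ∀ y, ‖q(h_y) − 1‖ ≤ T}`; this file bounds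
the complement ABSOLUTELY for NEAR pairs (`‖q(U_e) − q(V_e)‖ ≤ b ≤ T/(6L)` on all edges, links of `U` within `a` of `1`, `12La ≤ 1`):
★★ `kinDefect_ge_based_off_core` — a based field (`g_0 = 1`) with some `‖q(h_y) − 1‖ > T` has a jump `> T/(3L)` (path pinning `norm_su2Quat_sub_base_le`), its amplitude is
`≤ 3L·(max jump)` and the commutator-sharp edge bound `kinDefect_ge_of_jump` gives `kinDefect ≥ (T/(6L) − b)²` — the amplitude `a` of the slow links enters only through `6La ≤ 1/2`,
NOT through `a ≤ T` (which would be false: `a ~ β^{-s} ≫ T ~ β^{-1/2}·log³`);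
★★ `transferKernel_based_off_core_le` — hence `K_β(U, V^{bE h}) ≤ exp(2β|E| − β(T/(6L) − b)²)`; ★★★ `integral_basedKernel_off_core_le` — the integrated tail
`∫ 𝟙_{C_Tᶜ}(h) K_β(U, V^{bE h}) dh ≤ exp(2β|E|)·exp(−β(T/(6L) − b)²)` (the `τ` of `…BOStiffSlowAssembly.form_le_of_product_near` for near slow pairs; far pairs: `kinDefect_ge_far`).
HONEST FRAMING: bookkeeping for a stub of a child of the CONDITIONAL route R2b1; (B-ST) OPEN; C4-CORE OPEN; not infinite volume, not a gap, not Clay.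
-/

set_option autoImplicit false

noncomputable section

open MeasureTheory

namespace Summit.QuantumFields.YangMills.Theorems.FemtoTransferGap.TwoLattice.ConstTube

open Literature.MathematicalPhysics.QuantumFieldTheory Literature.MathematicalPhysics.QuantumLattice TwoLattice.Avg
open Literature.MathematicalPhysics.QuantumFieldTheory.Balaban1983to89.T4HaarSU2Translate

variable {L : ℕ} [NeZero L]

/-- ★★ **Off-core kinetic defect for based fields**: links of `U` within `a` of `1`, `‖q(U_e) − q(V_e)‖ ≤ b` on all edges, `12La ≤ 1`, `b ≤ T/(6L)`, and a based field `h`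
with SOME `‖q(h_y) − 1‖ > T`: `kinDefect U V (basedExt h) ≥ (T/(6L) − b)²`. [cite: Luscher1983, §3] -/
theorem kinDefect_ge_based_off_core (U V : GaugeConfig 3 L SU2) (h : NzSite L → SU2) {a b T : ℝ} (ha : ∀ e : Edge 3 L, ‖su2Quat (U e) - 1‖ ≤ a)
    (hb : ∀ e : Edge 3 L, ‖su2Quat (U e) - su2Quat (V e)‖ ≤ b) (hLa : 12 * L * a ≤ 1) (hTb : b ≤ T / (6 * L)) (hoff : ∃ y : NzSite L, T < ‖su2Quat (h y) - 1‖) :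
    (T / (6 * L) - b) ^ 2 ≤ kinDefect L U V (basedExt L h) := by
  obtain ⟨e₀, he₀⟩ := exists_max_jump (L := L) (basedExt L h)
  obtain ⟨y, hy⟩ := hoff
  set Rm := ‖su2Quat (basedExt L h (e₀.1.shift e₀.2)) - su2Quat (basedExt L h e₀.1)‖ with hRm
  have hL : (1 : ℝ) ≤ L := by exact_mod_cast NeZero.one_le
  have hL0 : (0 : ℝ) < L := by linarith
  have ha0 : 0 ≤ a := (norm_nonneg _).trans (ha default)
  have hb0 : 0 ≤ b := (norm_nonneg _).trans (hb default)
  -- path pinning from the origin: amplitude `≤ 3L·Rm`, hence `T < 3L·Rm`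
  have hpath := norm_su2Quat_sub_base_le (L := L) he₀
  have hamp : ∀ x : Site 3 L, ‖su2Quat (basedExt L h x) - 1‖ ≤ 3 * L * Rm := fun x => by
    have e : su2Quat (basedExt L h 0) = 1 := by rw [basedExt_zero, su2Quat_one]
    rw [← e]; exact hpath x
  have hT : T < 3 * L * Rm := by
    have e : su2Quat (h y) = su2Quat (basedExt L h y.1) := by rw [basedExt_of_ne L h y.2]
    rw [e] at hy
    exact hy.trans_le (hamp y.1)
  -- the commutator-sharp bound at the maximal edge
  have hpos : 0 ≤ Rm - 2 * a * (3 * L * Rm) - b := by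
    have h1 : 2 * a * (3 * L * Rm) ≤ Rm / 2 := by nlinarith [norm_nonneg (su2Quat (basedExt L h (e₀.1.shift e₀.2)) - su2Quat (basedExt L h e₀.1))]
    have h2 : T / (6 * L) ≤ Rm / 2 := by rw [div_le_iff₀ (by positivity)]; nlinarith
    linarith
  have hK := kinDefect_ge_of_jump U V (basedExt L h) e₀ le_rfl (ha e₀) (hb e₀) (hamp e₀.1) hpos
  refine le_trans (pow_le_pow_left₀ (by linarith) ?_ 2) hK
  have h1 : 2 * a * (3 * L * Rm) ≤ Rm / 2 := by nlinarith [norm_nonneg (su2Quat (basedExt L h (e₀.1.shift e₀.2)) - su2Quat (basedExt L h e₀.1))]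
  have h2 : T / (6 * L) ≤ Rm / 2 := by rw [div_le_iff₀ (by positivity)]; nlinarith
  linarith

/-- ★★ **Pointwise kernel tail off the core**: under the hypotheses of `kinDefect_ge_based_off_core` and `β ≥ 0`,
`K_β(U, V^{basedExt h}) ≤ exp(2β|E| − β (T/(6L) − b)²)`. [cite: Luscher1983, §3] -/
theorem transferKernel_based_off_core_le {β : ℝ} (hβ : 0 ≤ β) (U V : GaugeConfig 3 L SU2) (h : NzSite L → SU2) {a b T : ℝ}
    (ha : ∀ e : Edge 3 L, ‖su2Quat (U e) - 1‖ ≤ a) (hb : ∀ e : Edge 3 L, ‖su2Quat (U e) - su2Quat (V e)‖ ≤ b) (hLa : 12 * L * a ≤ 1) (hTb : b ≤ T / (6 * L))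
    (hoff : ∃ y : NzSite L, T < ‖su2Quat (h y) - 1‖) :
    transferKernel su2Rep β U (gaugeTransform (basedExt L h) V) ≤ Real.exp (β * (2 * (Fintype.card (Edge 3 L) : ℝ)) - β * (T / (6 * L) - b) ^ 2) := by
  refine (transferKernel_gaugeTransform_le hβ U V (basedExt L h)).trans (Real.exp_le_exp.2 ?_)
  have h := mul_le_mul_of_nonneg_left (kinDefect_ge_based_off_core U V h ha hb hLa hTb hoff) hβ
  linarith

/-- ★★★ **Integrated off-core tail of the based kernel**: with `C_T = {h | ∀ y, ‖q(h_y) − 1‖ ≤ T}`,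
`∫ 𝟙_{C_Tᶜ}(h)·K_β(U, V^{basedExt h}) dh ≤ exp(2β|E|)·exp(−β (T/(6L) − b)²)` for near pairs as above. [cite: Luscher1983, §3] -/
theorem integral_basedKernel_off_core_le {β : ℝ} (hβ : 0 ≤ β) (U V : GaugeConfig 3 L SU2) {a b T : ℝ}
    (ha : ∀ e : Edge 3 L, ‖su2Quat (U e) - 1‖ ≤ a) (hb : ∀ e : Edge 3 L, ‖su2Quat (U e) - su2Quat (V e)‖ ≤ b) (hLa : 12 * L * a ≤ 1) (hTb : b ≤ T / (6 * L)) :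
    ∫ h, {h : NzSite L → SU2 | ∀ y, ‖su2Quat (h y) - 1‖ ≤ T}ᶜ.indicator (fun h => transferKernel su2Rep β U (gaugeTransform (basedExt L h) V)) h ∂basedMeasure L ≤
      Real.exp (β * (2 * (Fintype.card (Edge 3 L) : ℝ))) * Real.exp (-(β * (T / (6 * L) - b) ^ 2)) := by
  haveI : IsProbabilityMeasure (basedMeasure L) := by infer_instance
  set B := Real.exp (β * (2 * (Fintype.card (Edge 3 L) : ℝ))) * Real.exp (-(β * (T / (6 * L) - b) ^ 2)) with hB
  have hB' : Real.exp (β * (2 * (Fintype.card (Edge 3 L) : ℝ)) - β * (T / (6 * L) - b) ^ 2) = B := by rw [hB, ← Real.exp_add]; ring_nf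
  have hpt : ∀ h : NzSite L → SU2, {h : NzSite L → SU2 | ∀ y, ‖su2Quat (h y) - 1‖ ≤ T}ᶜ.indicator (fun h => transferKernel su2Rep β U (gaugeTransform (basedExt L h) V)) h ≤ B := by
    intro h
    by_cases hh : h ∈ {h : NzSite L → SU2 | ∀ y, ‖su2Quat (h y) - 1‖ ≤ T}ᶜ
    · rw [Set.indicator_of_mem hh]
      have hoff : ∃ y : NzSite L, T < ‖su2Quat (h y) - 1‖ := by
        by_contra hne; push Not at hne; exact hh hne
      rw [← hB']; exact transferKernel_based_off_core_le hβ U V h ha hb hLa hTb hoff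
    · rw [Set.indicator_of_notMem hh]; positivity
  have h0 : ∀ h : NzSite L → SU2, 0 ≤ {h : NzSite L → SU2 | ∀ y, ‖su2Quat (h y) - 1‖ ≤ T}ᶜ.indicator (fun h => transferKernel su2Rep β U (gaugeTransform (basedExt L h) V)) h :=
    fun h => Set.indicator_nonneg (fun h _ => (transferKernel_pos su2Rep β _ _).le) h
  have hm := integral_mono_of_nonneg (μ := basedMeasure L) (ae_of_all _ h0) (integrable_const B) (ae_of_all _ hpt)
  simpa [integral_const] using hm

end Summit.QuantumFields.YangMills.Theorems.FemtoTransferGap.TwoLattice.ConstTube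

end
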